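import Summits.KontsevichZagierPeriods.Zeta5Search.Certificates.ModRedNK
import Summits.KontsevichZagierPeriods.Zeta5Search.Certificates.VIMLevel2NKEnd
import HarnessLib

/-!
# ζ(5) search — brown9 LEVEL 2 (R-NK): summation, endpoint terms, and the `n`-shift relation of `R(n,k₃)` (cell `pub-zeta5`, certifier `cert-2`)

HONEST FRAMING: systematic search; no irrationality claim unless certified.

From the termwise identity `ModRedNK.NK_termwise` (valid for `k ≤ n−1`; the certificate has a pole at the top index
`k = n`, exactly as the ttrl2 lane reports in `r1c/endpoint_R.json`): summing over `k < n` telescopes to `g(n) − g(0) = g(n)`,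
and the left-over ENDPOINT terms — `η₁₀·(sR (n+1) x n + sR (n+1) x (n+1)) + η₀₀·sR n x n + η₀₁·sR n (x+1) n + g(n)` — have
closed forms (at `q = n`, `T(n;p,n) = C(p,n)`; at `q = n+2`, `T(n+1;p,n+2) = (n+2)C(p,n+1) − (n+1)C(p−1,n+1)`) and cancel by a
POLYNOMIAL IDENTITY in `(n, x)` checked by the kernel on `Poly2` data (`endpointNK_isZero`, P1's `PolyReflect`).
RESULT `R_rel_NK`: for `n ≥ 3` and every non-integral rational `x`,
  `η₁₀(n,x)·R(n+1,x) + η₀₀(n,x)·R(n,x) + η₀₁(n,x)·R(n,x+1) = 0`  (`η` = `ev2 etaNK··`, the lane's telescoper ×5),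
i.e. the lane's relation (R-NK) (VIM.md §7, 2026-08-20T20:05Z). All rational `x` (polynomiality) and the integer form:
`ModRedNKAll.lean`.
-/

namespace Summit.KontsevichZagierPeriods.Zeta5Search.Certificates

namespace VIMInner.ModRed

open Finset
open Summit.KontsevichZagierPeriods.Zeta5Search.PolyReflect

/-! ### Closed forms of the inner block at `q = n` and `q = n+1` -/

/-- `T(M+1;p,M+2) = (M+2)·C(p,M+1) − (M+1)·C(p−1,M+1)`: only `j = 0, 1` survive. -/
theorem T_q_succ (M : ℕ) (p : ℚ) :
    T (M + 1) p ((M : ℚ) + 2) = ((M : ℚ) + 2) * bp (M + 1) p - ((M : ℚ) + 1) * bp (M + 1) (p - 1) := by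
  unfold T tT
  rw [sum_range_succ', sum_range_succ']
  have hrest : ∑ j ∈ range M, (-1 : ℚ) ^ (j + 1 + 1) * (((M + 1).choose (j + 1 + 1) : ℕ) : ℚ) *
      bp (M + 1) (p - ((j + 1 + 1 : ℕ) : ℚ)) * bp (M + 1) ((M : ℚ) + 2 - ((j + 1 + 1 : ℕ) : ℚ)) = 0 := by
    refine sum_eq_zero fun j hj => ?_
    have hjM : j < M := mem_range.mp hj
    have hc : (M - j).choose (M + 1) = 0 := Nat.choose_eq_zero_of_lt (by omega)
    rw [show (M : ℚ) + 2 - ((j + 1 + 1 : ℕ) : ℚ) = ((M - j : ℕ) : ℚ) by push_cast [hjM.le]; ring, bp_natCast, hc]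
    simp
  rw [hrest]
  have h0 : bp (M + 1) ((M : ℚ) + 2 - ((0 : ℕ) : ℚ)) = (M : ℚ) + 2 := by
    rw [show (M : ℚ) + 2 - ((0 : ℕ) : ℚ) = ((M + 2 : ℕ) : ℚ) by push_cast; ring, bp_natCast,
      show M + 2 = (M + 1) + 1 by ring, Nat.choose_succ_self_right]
    push_cast; ring
  have h1 : bp (M + 1) ((M : ℚ) + 2 - ((0 + 1 : ℕ) : ℚ)) = 1 := by
    rw [show (M : ℚ) + 2 - ((0 + 1 : ℕ) : ℚ) = ((M + 1 : ℕ) : ℚ) by push_cast; ring, bp_natCast, Nat.choose_self]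
    simp
  rw [h0, h1]
  simp
  ring

/-! ### The telescoped sum over `k < n` -/

/-- `g(0) = 0`: the certificate numerators `Ψ₀, Ψ₁` have no constant term in `k` (the lane: `Ψ ∋ k₅(k₅+1)`). -/
theorem gNK_zero (n : ℕ) (x : ℚ) : gNK n x 0 = 0 := by
  have h0 : ∀ w x : ℚ, ev3 PsiNK0 w x 0 = 0 := by intro w x; rw [PsiNK0, ev3_cons]; simp
  have h1 : ∀ w x : ℚ, ev3 PsiNK1 w x 0 = 0 := by intro w x; rw [PsiNK1, ev3_cons]; simp
  unfold gNK; simp [h0, h1]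

/-- Sum of the termwise identity over `k < n` (`n = m+3`): `η₁₀·Σ_{k<n} sR (n+1) x k + η₀₀·Σ_{k<n} sR n x k +
η₀₁·Σ_{k<n} sR n (x+1) k = g(n)`. -/
theorem NK_summed (m : ℕ) (x : ℚ) (hx : ∀ z : ℤ, x ≠ z) :
    ev2 etaNK10 (m + 3) x * ∑ k ∈ range (m + 3), sR (m + 4) x k
      + ev2 etaNK00 (m + 3) x * ∑ k ∈ range (m + 3), sR (m + 3) x k
      + ev2 etaNK01 (m + 3) x * ∑ k ∈ range (m + 3), sR (m + 3) (x + 1) k = gNK (m + 3) x (m + 3) := by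
  have h := telescope₃ (ev2 etaNK10 (m + 3) x) (ev2 etaNK00 (m + 3) x) (ev2 etaNK01 (m + 3) x)
    (sR (m + 4) x) (sR (m + 3) x) (sR (m + 3) (x + 1)) (gNK (m + 3) x) (m + 3)
    (fun k hk => NK_termwise m x hx k (by omega))
  rw [gNK_zero, sub_zero] at h
  exact h

/-! ### Closed forms at the endpoint `k = n` (`y = pOf n x n = 2n − x`, `V = fallProd (n−3) (y−1)`) -/

/-- `qOf n n = n`. -/
theorem qOf_self (n : ℕ) : qOf n n = (n : ℚ) := by unfold qOf; ring

/-- `qOf (m+4) (m+3) = (m+3) + 2`. -/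
theorem qOf_nsucc_self (m : ℕ) : qOf (m + 4) (m + 3) = ((m + 3 : ℕ) : ℚ) + 2 := by unfold qOf; push_cast; ring

/-- `(m+4)!·C(y,m+3) = (m+4)·y(y−m−1)(y−m−2)·V`. -/
theorem F_bp_y (m : ℕ) (y : ℚ) : (((m + 4).factorial : ℕ) : ℚ) * bp (m + 3) y =
    ((m : ℚ) + 4) * y * (y - m - 1) * (y - m - 2) * fallProd m (y - 1) := by
  unfold bp
  rw [fallProd_succ_pred (m + 2) y, fallProd_two m (y - 1), Nat.factorial_succ (m + 3)]
  have hf : (((m + 3).factorial : ℕ) : ℚ) ≠ 0 := by positivity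
  push_cast; field_simp; ring

/-- `(m+4)!·C(y−1,m+3) = (m+4)·(y−m−1)(y−m−2)(y−m−3)·V`. -/
theorem F_bp_ym1 (m : ℕ) (y : ℚ) : (((m + 4).factorial : ℕ) : ℚ) * bp (m + 3) (y - 1) =
    ((m : ℚ) + 4) * (y - m - 1) * (y - m - 2) * (y - m - 3) * fallProd m (y - 1) := by
  unfold bp
  rw [fallProd_three m (y - 1), Nat.factorial_succ (m + 3)]
  have hf : (((m + 3).factorial : ℕ) : ℚ) ≠ 0 := by positivity
  push_cast; field_simp; ring

/-- `(m+4)!·C(y+1,m+3) = (m+4)·(y+1)y(y−m−1)·V`. -/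
theorem F_bp_yp1 (m : ℕ) (y : ℚ) : (((m + 4).factorial : ℕ) : ℚ) * bp (m + 3) (y + 1) =
    ((m : ℚ) + 4) * (y + 1) * y * (y - m - 1) * fallProd m (y - 1) := by
  unfold bp
  rw [fallProd_succ_pred (m + 2) (y + 1), show y + 1 - 1 = y by ring, fallProd_succ_pred (m + 1) y,
    fallProd_succ m (y - 1), Nat.factorial_succ (m + 3)]
  have hf : (((m + 3).factorial : ℕ) : ℚ) ≠ 0 := by positivity
  push_cast; field_simp; ring

/-- `(m+4)!·C(y+3,m+4) = (y+3)(y+2)(y+1)y·V`. -/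
theorem F_bp_yp3 (m : ℕ) (y : ℚ) : (((m + 4).factorial : ℕ) : ℚ) * bp (m + 4) (y + 3) =
    (y + 3) * (y + 2) * (y + 1) * y * fallProd m (y - 1) := by
  unfold bp
  rw [show y + 3 = (y - 1) + 4 by ring, fallProd_four_shift]
  have hf : (((m + 4).factorial : ℕ) : ℚ) ≠ 0 := by positivity
  field_simp; ring

/-- `(m+4)!·C(y+2,m+4) = (y+2)(y+1)y(y−m−1)·V`. -/
theorem F_bp_yp2 (m : ℕ) (y : ℚ) : (((m + 4).factorial : ℕ) : ℚ) * bp (m + 4) (y + 2) =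
    (y + 2) * (y + 1) * y * (y - m - 1) * fallProd m (y - 1) := by
  unfold bp
  rw [fallProd_succ_pred (m + 3) (y + 2), show y + 2 - 1 = y + 1 by ring, fallProd_succ_pred (m + 2) (y + 1),
    show y + 1 - 1 = y by ring, fallProd_succ_pred (m + 1) y, fallProd_succ m (y - 1)]
  have hf : (((m + 4).factorial : ℕ) : ℚ) ≠ 0 := by positivity
  field_simp; ring

/-! ### The endpoint polynomial identity (kernel, on `Poly2` data) -/

/-- The endpoint polynomial in `(n, x)` (P1's `Poly2`; `y = 2n − x`, `Ψᵢ(n,x,n)` by `substK`):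
`η₁₀[(n+1)(y+3)(y+2)(y+1)y((n+2)(y+3)(y+2)(y+1)y − (n+1)(y+2)(y+1)y(y−n+2)) − ((y+2)(y+1)y(y−n+2))²]`
`+ η₀₀(n+1)²y²(y−n+2)²(y−n+1)² + η₀₁(n+1)²(y−n+2)²(y−n+1)²(y−n)² + (n+1)y(Ψ₀(n,x,n)(y−n+1) + Ψ₁(n,x,n)(y+1))`. -/
def endNKPoly : Poly2 :=
    (add2 (add2 (add2 (mul2 etaNK10 (sub2 (mul2 (mul2 (mul2 (mul2 (mul2 (lin2 1 0 1) (lin2 2 (-1) 3)) (lin2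
    2 (-1) 2)) (lin2 2 (-1) 1)) (lin2 2 (-1) 0)) (sub2 (mul2 (mul2 (mul2 (mul2 (lin2 1 0 2) (lin2 2 (-1)
    3)) (lin2 2 (-1) 2)) (lin2 2 (-1) 1)) (lin2 2 (-1) 0)) (mul2 (mul2 (mul2 (mul2 (lin2 1 0 1) (lin2 2
    (-1) 2)) (lin2 2 (-1) 1)) (lin2 2 (-1) 0)) (lin2 1 (-1) 2)))) (pow2 (mul2 (mul2 (mul2 (lin2 2 (-1) 2)
    (lin2 2 (-1) 1)) (lin2 2 (-1) 0)) (lin2 1 (-1) 2)) 2))) (mul2 etaNK00 (pow2 (mul2 (mul2 (mul2 (lin2 1 0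
    1) (lin2 2 (-1) 0)) (lin2 1 (-1) 2)) (lin2 1 (-1) 1)) 2))) (mul2 etaNK01 (pow2 (mul2 (mul2 (mul2 (lin2
    1 0 1) (lin2 1 (-1) 2)) (lin2 1 (-1) 1)) (lin2 1 (-1) 0)) 2))) (mul2 (mul2 (lin2 1 0 1) (lin2 2 (-1)
    0)) (add2 (mul2 (substK PsiNK0 [[0, 1]]) (lin2 1 (-1) 1)) (mul2 (substK PsiNK1 [[0, 1]]) (lin2 2 (-1)
    1)))))

/-- **The endpoint polynomial vanishes identically** (kernel computation on the data). -/
theorem endNKPoly_isZero : isZero2 endNKPoly = true := by decide +kernel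

/-- The endpoint identity as a statement about values (`w = n`, `y = 2n − x`). -/
theorem endNK_eval (w x : ℚ) :
    ev2 etaNK10 w x * ((w + 1) * (2 * w - x + 3) * (2 * w - x + 2) * (2 * w - x + 1) * (2 * w - x) *
        ((w + 2) * (2 * w - x + 3) * (2 * w - x + 2) * (2 * w - x + 1) * (2 * w - x)
          - (w + 1) * (2 * w - x + 2) * (2 * w - x + 1) * (2 * w - x) * (2 * w - x - w + 2))
        - ((2 * w - x + 2) * (2 * w - x + 1) * (2 * w - x) * (2 * w - x - w + 2)) ^ 2)
    + ev2 etaNK00 w x * ((w + 1) * (2 * w - x) * (2 * w - x - w + 2) * (2 * w - x - w + 1)) ^ 2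
    + ev2 etaNK01 w x * ((w + 1) * (2 * w - x - w + 2) * (2 * w - x - w + 1) * (2 * w - x - w)) ^ 2
    + (w + 1) * (2 * w - x) * (ev3 PsiNK0 w x w * (2 * w - x - w + 1) + ev3 PsiNK1 w x w * (2 * w - x + 1)) = 0 := by
  have h := ev2_eq_zero_of_isZero2 _ w x endNKPoly_isZero
  simp only [endNKPoly, ev2_add2, ev2_sub2, ev2_mul2, ev2_pow2, ev2_lin2, ev2_substK] at h
  have hw : ev2 [[0, 1]] w x = w := by simp [ev2, ev1]
  rw [hw] at h
  push_cast at h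
  linear_combination h

/-! ### The endpoint terms cancel -/

set_option maxHeartbeats 4000000 in
/-- **Endpoint bookkeeping** (`n = m+3`): the terms left over from the telescoped sum vanish,
`η₁₀·(sR (n+1) x n + sR (n+1) x (n+1)) + η₀₀·sR n x n + η₀₁·sR n (x+1) n + g(n) = 0` (non-integral `x`). -/
theorem NK_endpoint (m : ℕ) (x : ℚ) (hx : ∀ z : ℤ, x ≠ z) :
    ev2 etaNK10 (m + 3) x * (sR (m + 4) x (m + 3) + sR (m + 4) x (m + 4))
      + ev2 etaNK00 (m + 3) x * sR (m + 3) x (m + 3) + ev2 etaNK01 (m + 3) x * sR (m + 3) (x + 1) (m + 3)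
      + gNK (m + 3) x (m + 3) = 0 := by
  -- non-vanishing
  have hF : (((m + 4).factorial : ℕ) : ℚ) ≠ 0 := by positivity
  have hy0 : pOf (m + 3) x (m + 3) ≠ 0 := by exact_mod_cast pOf_ne_int hx (m + 3) (m + 3) 0
  have hya : pOf (m + 3) x (m + 3) - ((m + 3 : ℕ) : ℚ) + 2 ≠ 0 := by
    have := pOf_ne_int hx (m + 3) (m + 3) (m + 1); push_cast at this ⊢; intro h; apply this; linarith
  have hyb : pOf (m + 3) x (m + 3) - ((m + 3 : ℕ) : ℚ) + 1 ≠ 0 := by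
    have := pOf_ne_int hx (m + 3) (m + 3) (m + 2); push_cast at this ⊢; intro h; apply this; linarith
  have hm4 : (((m + 3 : ℕ) : ℚ) + 1) ≠ 0 := by positivity
  have hone : (((m + 3 : ℕ) : ℚ) + 1 - ((m + 3 : ℕ) : ℚ)) ≠ 0 := by norm_num
  have hD : ddenNK (m + 3) x (m + 3) ≠ 0 := by
    unfold ddenNK
    exact mul_ne_zero (mul_ne_zero (mul_ne_zero (mul_ne_zero hm4 hy0) (pow_ne_zero 2 hone)) (pow_ne_zero 2 hya)) hyb
  -- the certificate value at `k = n`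
  have eG : gNK (m + 3) x (m + 3) * ddenNK (m + 3) x (m + 3) = hR (m + 3) x (m + 3) *
      (ev3 PsiNK0 ((m + 3 : ℕ) : ℚ) x ((m + 3 : ℕ) : ℚ) * T (m + 3) (pOf (m + 3) x (m + 3)) (qOf (m + 3) (m + 3))
        + ev3 PsiNK1 ((m + 3 : ℕ) : ℚ) x ((m + 3 : ℕ) : ℚ) * T (m + 3) (pOf (m + 3) x (m + 3) + 1)
          (qOf (m + 3) (m + 3))) := by
    unfold gNK; exact div_mul_cancel₀ _ hD
  -- closed forms of the binomials, the inner blocks and the signs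
  have hc43 : (((m + 4).choose (m + 3) : ℕ) : ℚ) = (m : ℚ) + 4 := by
    rw [show (m + 4).choose (m + 3) = m + 3 + 1 from Nat.choose_succ_self_right (m + 3)]; push_cast; ring
  have hs4 : ((-1 : ℚ)) ^ (m + 4) = -((-1 : ℚ) ^ (m + 3)) := by
    rw [show m + 4 = (m + 3) + 1 from rfl, pow_succ]; ring
  have e43 : pOf (m + 4) x (m + 3) = pOf (m + 3) x (m + 3) + 3 := by unfold pOf; push_cast; ring
  have e44 : pOf (m + 4) x (m + 4) = pOf (m + 3) x (m + 3) + 2 := by unfold pOf; push_cast; ring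
  have e3x : pOf (m + 3) (x + 1) (m + 3) = pOf (m + 3) x (m + 3) - 1 := pOf_xsucc _ _ _
  have hT43 : T (m + 4) (pOf (m + 3) x (m + 3) + 3) (((m + 3 : ℕ) : ℚ) + 2) =
      (((m + 3 : ℕ) : ℚ) + 2) * bp (m + 4) (pOf (m + 3) x (m + 3) + 3)
        - (((m + 3 : ℕ) : ℚ) + 1) * bp (m + 4) (pOf (m + 3) x (m + 3) + 3 - 1) := T_q_succ (m + 3) _
  have hT44 : T (m + 4) (pOf (m + 3) x (m + 3) + 2) (((m + 4 : ℕ) : ℚ)) = bp (m + 4) (pOf (m + 3) x (m + 3) + 2) :=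
    T_q_self (m + 4) _
  have hT33 : T (m + 3) (pOf (m + 3) x (m + 3)) (((m + 3 : ℕ) : ℚ)) = bp (m + 3) (pOf (m + 3) x (m + 3)) :=
    T_q_self (m + 3) _
  have hT3p : T (m + 3) (pOf (m + 3) x (m + 3) + 1) (((m + 3 : ℕ) : ℚ)) = bp (m + 3) (pOf (m + 3) x (m + 3) + 1) :=
    T_q_self (m + 3) _
  have hT3m : T (m + 3) (pOf (m + 3) x (m + 3) - 1) (((m + 3 : ℕ) : ℚ)) = bp (m + 3) (pOf (m + 3) x (m + 3) - 1) :=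
    T_q_self (m + 3) _
  have L0 := F_bp_y m (pOf (m + 3) x (m + 3))
  have Lm := F_bp_ym1 m (pOf (m + 3) x (m + 3))
  have Lp := F_bp_yp1 m (pOf (m + 3) x (m + 3))
  have L3 := F_bp_yp3 m (pOf (m + 3) x (m + 3))
  have L2 := F_bp_yp2 m (pOf (m + 3) x (m + 3))
  have hpoly := endNK_eval ((m + 3 : ℕ) : ℚ) x
  -- rewrite everything in closed form
  unfold sR hR at eG ⊢
  rw [qOf_self, hT33, hT3p, Nat.choose_self] at eG
  rw [e43, e44, e3x, qOf_nsucc_self, qOf_self, qOf_self, hT43,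
    show pOf (m + 3) x (m + 3) + 3 - 1 = pOf (m + 3) x (m + 3) + 2 by ring, hT44, hT33, hT3m, hc43, hs4,
    Nat.choose_self, Nat.choose_self]
  unfold ddenNK at eG hD
  push_cast at eG L0 Lm Lp L3 L2 hpoly hD ⊢
  set V := fallProd m (pOf (m + 3) x (m + 3) - 1) with hV
  set F : ℚ := (((m + 4).factorial : ℕ) : ℚ) with hFdef
  set sgn : ℚ := (-1 : ℚ) ^ (m + 3) with hsgn
  set b0 := bp (m + 3) (pOf (m + 3) x (m + 3))
  set bm := bp (m + 3) (pOf (m + 3) x (m + 3) - 1)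
  set bq := bp (m + 3) (pOf (m + 3) x (m + 3) + 1)
  set c3 := bp (m + 4) (pOf (m + 3) x (m + 3) + 3)
  set c2 := bp (m + 4) (pOf (m + 3) x (m + 3) + 2)
  set g := gNK (m + 3) x (m + 3)
  set η10 := ev2 etaNK10 ((m : ℚ) + 3) x
  set η00 := ev2 etaNK00 ((m : ℚ) + 3) x
  set η01 := ev2 etaNK01 ((m : ℚ) + 3) x
  set Ψ0n := ev3 PsiNK0 ((m : ℚ) + 3) x ((m : ℚ) + 3)
  set Ψ1n := ev3 PsiNK1 ((m : ℚ) + 3) x ((m : ℚ) + 3)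
  unfold pOf at *
  push_cast at *
  have hFD : F ^ 2 * (((m : ℚ) + 3 + 1) * (3 * ((m : ℚ) + 3) - x - ((m : ℚ) + 3)) * ((m : ℚ) + 3 + 1 - ((m : ℚ) + 3)) ^ 2 * ((3 * ((m : ℚ) + 3) - x - ((m : ℚ) + 3)) - ((m : ℚ) + 3) + 2) ^ 2 * ((3 * ((m : ℚ) + 3) - x - ((m : ℚ) + 3)) - ((m : ℚ) + 3) + 1)) ≠ 0 := mul_ne_zero (pow_ne_zero 2 hF) hD
  apply mul_left_cancel₀ hFD
  linear_combination (F ^ 2) * eG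
    + (sgn * ((((m : ℚ) + 3 + 1) * (3 * ((m : ℚ) + 3) - x - ((m : ℚ) + 3)) * ((m : ℚ) + 3 + 1 - ((m : ℚ) + 3)) ^ 2 * ((3 * ((m : ℚ) + 3) - x - ((m : ℚ) + 3)) - ((m : ℚ) + 3) + 2) ^ 2 * ((3 * ((m : ℚ) + 3) - x - ((m : ℚ) + 3)) - ((m : ℚ) + 3) + 1)) * η10 * (((m : ℚ) + 4) * ((m : ℚ) + 5) * (F * c3 + (((3 * ((m : ℚ) + 3) - x - ((m : ℚ) + 3)) + 3) * ((3 * ((m : ℚ) + 3) - x - ((m : ℚ) + 3)) + 2) * ((3 * ((m : ℚ) + 3) - x - ((m : ℚ) + 3)) + 1) * (3 * ((m : ℚ) + 3) - x - ((m : ℚ) + 3)) * V)) - ((m : ℚ) + 4) ^ 2 * (F * c2)))) * L3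
    + (sgn * ((((m : ℚ) + 3 + 1) * (3 * ((m : ℚ) + 3) - x - ((m : ℚ) + 3)) * ((m : ℚ) + 3 + 1 - ((m : ℚ) + 3)) ^ 2 * ((3 * ((m : ℚ) + 3) - x - ((m : ℚ) + 3)) - ((m : ℚ) + 3) + 2) ^ 2 * ((3 * ((m : ℚ) + 3) - x - ((m : ℚ) + 3)) - ((m : ℚ) + 3) + 1)) * η10 * (-((m : ℚ) + 4) ^ 2 * (((3 * ((m : ℚ) + 3) - x - ((m : ℚ) + 3)) + 3) * ((3 * ((m : ℚ) + 3) - x - ((m : ℚ) + 3)) + 2) * ((3 * ((m : ℚ) + 3) - x - ((m : ℚ) + 3)) + 1) * (3 * ((m : ℚ) + 3) - x - ((m : ℚ) + 3)) * V) - (F * c2 + (((3 * ((m : ℚ) + 3) - x - ((m : ℚ) + 3)) + 2) * ((3 * ((m : ℚ) + 3) - x - ((m : ℚ) + 3)) + 1) * (3 * ((m : ℚ) + 3) - x - ((m : ℚ) + 3)) * ((3 * ((m : ℚ) + 3) - x - ((m : ℚ) + 3)) - m - 1) * V))))) * L2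
    + (sgn * ((((m : ℚ) + 3 + 1) * (3 * ((m : ℚ) + 3) - x - ((m : ℚ) + 3)) * ((m : ℚ) + 3 + 1 - ((m : ℚ) + 3)) ^ 2 * ((3 * ((m : ℚ) + 3) - x - ((m : ℚ) + 3)) - ((m : ℚ) + 3) + 2) ^ 2 * ((3 * ((m : ℚ) + 3) - x - ((m : ℚ) + 3)) - ((m : ℚ) + 3) + 1)) * η00 * (F * b0 + (((m : ℚ) + 4) * (3 * ((m : ℚ) + 3) - x - ((m : ℚ) + 3)) * ((3 * ((m : ℚ) + 3) - x - ((m : ℚ) + 3)) - m - 1) * ((3 * ((m : ℚ) + 3) - x - ((m : ℚ) + 3)) - m - 2) * V)) + Ψ0n * (F * b0 + (((m : ℚ) + 4) * (3 * ((m : ℚ) + 3) - x - ((m : ℚ) + 3)) * ((3 * ((m : ℚ) + 3) - x - ((m : ℚ) + 3)) - m - 1) * ((3 * ((m : ℚ) + 3) - x - ((m : ℚ) + 3)) - m - 2) * V)) + Ψ1n * (F * bq))) * L0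
    + (sgn * ((((m : ℚ) + 3 + 1) * (3 * ((m : ℚ) + 3) - x - ((m : ℚ) + 3)) * ((m : ℚ) + 3 + 1 - ((m : ℚ) + 3)) ^ 2 * ((3 * ((m : ℚ) + 3) - x - ((m : ℚ) + 3)) - ((m : ℚ) + 3) + 2) ^ 2 * ((3 * ((m : ℚ) + 3) - x - ((m : ℚ) + 3)) - ((m : ℚ) + 3) + 1)) * η01 * (F * bm + (((m : ℚ) + 4) * ((3 * ((m : ℚ) + 3) - x - ((m : ℚ) + 3)) - m - 1) * ((3 * ((m : ℚ) + 3) - x - ((m : ℚ) + 3)) - m - 2) * ((3 * ((m : ℚ) + 3) - x - ((m : ℚ) + 3)) - m - 3) * V)))) * Lm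
    + (sgn * (Ψ1n * (((m : ℚ) + 4) * (3 * ((m : ℚ) + 3) - x - ((m : ℚ) + 3)) * ((3 * ((m : ℚ) + 3) - x - ((m : ℚ) + 3)) - m - 1) * ((3 * ((m : ℚ) + 3) - x - ((m : ℚ) + 3)) - m - 2) * V))) * Lp
    + (sgn * V ^ 2 * (((m : ℚ) + 3 + 1) * (3 * ((m : ℚ) + 3) - x - ((m : ℚ) + 3)) * ((m : ℚ) + 3 + 1 - ((m : ℚ) + 3)) ^ 2 * ((3 * ((m : ℚ) + 3) - x - ((m : ℚ) + 3)) - ((m : ℚ) + 3) + 2) ^ 2 * ((3 * ((m : ℚ) + 3) - x - ((m : ℚ) + 3)) - ((m : ℚ) + 3) + 1))) * hpoly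

/-! ### (R-NK) for non-integral rational `x` -/

/-- **(R-NK)**: for `n ≥ 3` and every rational `x` that is not an integer, the inner double sum satisfies the lane's
`n`-shift relation `η₁₀(n,x)·R(n+1,x) + η₀₀(n,x)·R(n,x) + η₀₁(n,x)·R(n,x+1) = 0`. (All `x`: `ModRedNKAll`.) -/
theorem R_rel_NK (n : ℕ) (hn : 3 ≤ n) (x : ℚ) (hx : ∀ z : ℤ, x ≠ z) :
    ev2 etaNK10 n x * Rsum (n + 1) x + ev2 etaNK00 n x * Rsum n x + ev2 etaNK01 n x * Rsum n (x + 1) = 0 := by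
  obtain ⟨m, rfl⟩ : ∃ m, n = m + 3 := ⟨n - 3, by omega⟩
  have hs := NK_summed m x hx
  have he := NK_endpoint m x hx
  have e1 : Rsum (m + 4) x = ∑ k ∈ range (m + 3), sR (m + 4) x k + sR (m + 4) x (m + 3) + sR (m + 4) x (m + 4) := by
    unfold Rsum; rw [sum_range_succ, sum_range_succ]
  have e2 : Rsum (m + 3) x = ∑ k ∈ range (m + 3), sR (m + 3) x k + sR (m + 3) x (m + 3) := by
    unfold Rsum; rw [sum_range_succ]
  have e3 : Rsum (m + 3) (x + 1) = ∑ k ∈ range (m + 3), sR (m + 3) (x + 1) k + sR (m + 3) (x + 1) (m + 3) := by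
    unfold Rsum; rw [sum_range_succ]
  rw [show m + 3 + 1 = m + 4 from rfl, e1, e2, e3]
  push_cast at hs he ⊢
  linear_combination hs + he

end VIMInner.ModRed

end Summit.KontsevichZagierPeriods.Zeta5Search.Certificates
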